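import Summits.BirchSwinnertonDyer.Rank1Residual.Additive.GordRankOneIwasawa
import HarnessLib

/-!
# The (G)-cell: the typed Main-Conjecture inputs at `T = 0` and at order one are EXACTLY `BSD(E,p)`
# on the non-anomalous rows — converses and `iff`s (cell `b2b-bsdres`, sub-cell additive-p2, gen 18)

HONEST FRAMING (cell `b2b-bsdres`, run/shared/lean/b2b/bsd-rank1-residual/, verbatim in every
file): the goal of the cell is to DELETE the COMBINATION-SHAPED residual classes of the
Birch–Swinnerton-Dyer formula for ALL analytic-rank `≤ 1` elliptic curves over `ℚ` — "full BSD
formula for every rank `≤ 1` curve in class `C`" assembled STRICTLY from published theorems — so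
that the rank-`≤ 1` remainder becomes exactly the CONSTRUCTION-SHAPED classes, which are TYPED
(missing-input `Prop`s), NOT attempted. This is not "finishing BSD". Sub-cell `additive-p2`, gen 18:
research route; no claim beyond the stated classes; X3♯(G-ord)/X4♯(G-ord) stay CONSTRUCTION-SHAPED;
labels / census / located gap UNCHANGED; nothing is booked. Theorems only (no `def`, no new fact).

## What and why

`GordCharLeadingTerm[Consequences]` (rank `0`) and `GordRankOneIwasawa[Classes]` (rank `1`) proved
that the typed EQUALITY inputs — `CycCharLeadingTermAt W p` (every generator of `char_Λ X(E/ℚ_∞)`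
has `f(0) = u · L(E,1)/Ω_E`) and `CycCharLeadingTermOneAt W p Dh` (`[T¹]f · log_p γ_cyc = u · q · Reg_p`)
— IMPLY `BSD(E,p)` off the anomalous rows of Delbourgo's (G)-cell, through Delbourgo 2002 (A)+(B).
This file proves the CONVERSES from the same published inputs: on those rows `BSD(E,p)` IMPLIES the
typed equality (rank `0`), resp. implies it for every height datum `Dh` satisfying Delbourgo's
clauses non-degenerately (rank `1`). So the typed inputs conjecture NOTHING beyond the `p`-part of
BSD there — the cell's residue statements are EXACT, not merely sufficient (team n1011's
`cycLowerBoundAt_iff_missingLowerBoundAt`, seat p01, is the analogue for the LOWER divisibility /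
lower half; this is the equality / full `BSD(E,p)` version). Mechanism: `BSD(E,p)` pins
`ord_p #Ш_an = ord_p #Ш`; (B) with `ℓ = 1` pins the algebraic leading term to `#Ш[p^∞]·(Reg_p)·∏c_v/#tors²`
up to a unit; the quotient by the analytic quantity has valuation `0`, hence is a unit of `ℤ_p`
(`exists_units_coe_eq_of_valuation_eq_zero`).

* `cycCharLeadingTermAt_of_bsdp_of_nonAnomalous`, `cycCharLeadingTermAt_iff_bsdp_rankZero` (rank `0`);
* `cycCharLeadingTermOneAt_of_bsdp_of_nonAnomalous`, `cycCharLeadingTermOneAt_iff_bsdp_rankOne`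
  (rank `1`, for a datum with `LeadingTermClauses ∧ SchneiderConjecture`);
* `rankOneIwasawaInputAt_iff_bsdp_and_exists_height`: on the non-anomalous rows the residue predicate
  is `BSD(E,p) ∧ ∃ Dh, LeadingTermClauses W p Dh ∧ SchneiderConjecture Dh` — i.e. modulo the
  per-pair Schneider certificate for Delbourgo's height, it IS `BSD(E,p)`.

References: D. Delbourgo, J. Number Theory 95 (2002) Theorem (A), (B) [Delbourgo2002]; R. L. Miller,
LMS J. Comput. Math. 14 (2011) Def. 1.1 [Miller2011LMS].
-/

noncomputable section

open scoped Classical NumberField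

open WeierstrassCurve NumberField Literature.NumberTheory.EllipticCurves
  Literature.NumberTheory.EllipticCurves.ModularForms
  Literature.NumberTheory.EllipticCurves.Rank1Residual
  Literature.NumberTheory.EllipticCurves.Rank1Residual.Typed
  IsDedekindDomain

namespace Summit.BirchSwinnertonDyer.Rank1Residual.Additive

variable (W : WeierstrassCurve ℚ) {p : ℕ} [hp : Fact p.Prime]

/-- A non-zero `p`-adic number of valuation `0` is (the image of) a unit of `ℤ_p`. [folklore] -/
theorem exists_units_coe_eq_of_valuation_eq_zero {x : ℚ_[p]} (hx : x ≠ 0) (hv : x.valuation = 0) :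
    ∃ u : ℤ_[p]ˣ, ((u : ℤ_[p]) : ℚ_[p]) = x := by
  have hnorm : ‖x‖ = 1 := by
    rw [Padic.norm_eq_zpow_neg_valuation hx, hv, neg_zero, zpow_zero]
  let z : ℤ_[p] := ⟨x, hnorm.le⟩
  have hz : IsUnit z := PadicInt.isUnit_iff.mpr (by simpa [z] using hnorm)
  exact ⟨hz.unit, by simp [IsUnit.unit_spec, z]⟩

variable (p) [W.IsElliptic] [W.IsGloballyMinimal]

/-! ### Rank `0`: `BSD(E,p)` ⟹ the MC equality at `T = 0`, off the anomalous rows -/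

/-- **CONVERSE at rank `0`.** On the (G)-cell (`Addv ∧ TypeGOrd`, `E` non-CM, `p ≥ 5`,
`ord_{s=1} L(E,s) = 0`), off the anomalous rows, `BSD(E,p)` IMPLIES the typed MC equality at `T = 0`
`CycCharLeadingTermAt W p`: by Delbourgo 2002 (A)+(B) every generator has
`f(0) · #E(ℚ)_tors² = u' · #Ш[p^∞] · ∏c_v`, while `BSD(E,p)` gives `L(E,1)/Ω_E = #Ш_an · ∏c_v/#tors²`
with `ord_p #Ш_an = ord_p #Ш`; the quotient `f(0) / (L(E,1)/Ω_E) = u' · #Ш[p^∞]/#Ш_an` has valuation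
`0`, hence is a unit. [cite: Delbourgo2002, Theorem (A), (B) (p. 40)] [cite: Miller2011LMS, Def. 1.1] -/
theorem cycCharLeadingTermAt_of_bsdp_of_nonAnomalous (hDel : Delbourgo2002.mainTheorem)
    (hGZK : rank_eq_analyticRank_of_analyticRank_le_one) (hmod : hasEntireLFunction_rat)
    (hp5 : 5 ≤ p) (hcm : ¬ W.HasCM) (hadd : Addv W p) (hG : TypeGOrd W p)
    (hr : W.analyticRank = 0) (hna : Delbourgo2002.ReductionNonAnomalous W p) (hbsd : BSDp W p) :
    CycCharLeadingTermAt W p := by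
  classical
  have hpP : p.Prime := hp.out
  -- rank 0 facts
  have hL : W.entireLFunction 1 ≠ 0 := (W.analyticRank_eq_zero_iff_holds (hmod W)).mp hr
  obtain ⟨hmw, hfin⟩ := hGZK W (by rw [hr]; exact zero_le_one)
  have hmw0 : W.mordellWeilRank = 0 := by rw [hmw, hr]
  haveI : Finite W.sha := hfin
  haveI hE : Finite W.toAffine.Point := W.finite_point_of_rank_zero hmw0
  have hfinp : Finite (AddCommGroup.primaryComponent W.sha p) := inferInstance
  -- `BSD(E,p)`: `#Ш_an = s`, `ord_p s = ord_p #Ш[p^∞]`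
  obtain ⟨-, -, s, hs, hvs⟩ := hbsd
  -- positivity
  have hΩpos : 0 < W.realPeriodRat := W.realPeriodRat_pos_holds
  have hT0 : W.torsionOrder ≠ 0 := (W.torsionOrder_pos_holds).ne'
  have hPpos : 0 < W.tamagawaProduct := W.tamagawaProduct_pos_holds
  -- `q := s · ∏c_v / #tors²` satisfies `L(E,1) = q · Ω_E`
  set q : ℚ := s * (W.tamagawaProduct : ℚ) / (W.torsionOrder : ℚ) ^ 2 with hq_def
  have hLq : W.entireLFunction 1 = (q : ℂ) * (W.realPeriodRat : ℂ) := by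
    have hΩC : (W.realPeriodRat : ℂ) ≠ 0 := by exact_mod_cast hΩpos.ne'
    have hTC : (W.torsionOrder : ℂ) ≠ 0 := by exact_mod_cast hT0
    have hPC : (W.tamagawaProduct : ℂ) ≠ 0 := by exact_mod_cast hPpos.ne'
    have hRC : (W.regulator : ℂ) = 1 := by
      rw [W.regulator_eq_one_of_rank_zero hmw0]; norm_num
    have h := hs
    rw [shaAn_def, W.leadingLCoeff_eq_of_analyticRank_eq_zero hr, hRC, mul_one,
      div_eq_iff (mul_ne_zero hΩC hPC)] at h
    rw [hq_def]
    push_cast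
    field_simp
    linear_combination h
  have hs0 : s ≠ 0 := by
    intro h0
    apply hL
    rw [hLq, hq_def, h0]
    simp
  -- the typed statement
  intro κ γ hκ hγ hγ' D f hf
  haveI : Module.Finite (IwasawaAlgebra p) D.X :=
    SelmerDualData.module_finite_of_isCyclotomic (W := W) (κ := κ) hκ D hγ
  have hadd' : ¬ W.HasGoodReductionAtPrime p ∧ ¬ W.HasMultiplicativeReductionAtPrime p := hadd
  have hX : D.IsTorsion := Delbourgo2002.mainTheorem.isTorsion hDel hp5 hcm hadd' hG hκ hγ D
  obtain ⟨Dh, hB⟩ := Delbourgo2002.mainTheorem.exists_leadingTermClauses hDel hp5 hcm hadd' hG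
  obtain ⟨-, u, ℓ, -, hℓ1, heq⟩ := hB.constantCoeff hκ hγ hγ' D hX hf hfinp
  rw [hℓ1 hna, Nat.cast_one, mul_one] at heq
  -- abbreviations in `ℚ_p`
  set f0 : ℚ_[p] := ((PowerSeries.constantCoeff f : ℤ_[p]) : ℚ_[p]) with hf0_def
  set Shp : ℚ_[p] := (Nat.card (AddCommGroup.primaryComponent W.sha p) : ℚ_[p]) with hShp_def
  set uQ : ℚ_[p] := ((u : ℤ_[p]) : ℚ_[p]) with huQ_def
  have hsQ : ((s : ℚ) : ℚ_[p]) ≠ 0 := by exact_mod_cast hs0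
  have hu0 : uQ ≠ 0 := coe_units_ne_zero p u
  have hShp0 : Shp ≠ 0 := by rw [hShp_def]; exact_mod_cast Nat.card_pos.ne'
  have hT2Q : (W.torsionOrder : ℚ_[p]) ^ 2 ≠ 0 := pow_ne_zero 2 (by exact_mod_cast hT0)
  have hPQ : (W.tamagawaProduct : ℚ_[p]) ≠ 0 := by exact_mod_cast hPpos.ne'
  -- the would-be unit `x := u · #Ш[p^∞] / s`
  set x : ℚ_[p] := uQ * Shp / ((s : ℚ) : ℚ_[p]) with hx_def
  have hx0 : x ≠ 0 := by rw [hx_def]; exact div_ne_zero (mul_ne_zero hu0 hShp0) hsQ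
  have hxval : x.valuation = 0 := by
    have hprod : x * ((s : ℚ) : ℚ_[p]) = uQ * Shp := by rw [hx_def]; field_simp
    have hv := congrArg Padic.valuation hprod
    rw [Padic.valuation_mul hx0 hsQ, Padic.valuation_mul hu0 hShp0, huQ_def,
      valuation_coe_units_eq_zero, zero_add, Padic.valuation_ratCast, hShp_def,
      Padic.valuation_natCast, hvs] at hv
    linarith
  obtain ⟨u', hu'⟩ := exists_units_coe_eq_of_valuation_eq_zero hx0 hxval
  refine ⟨u', q, hLq, ?_⟩
  -- `f(0) = x · q`
  have hf0eq : f0 = uQ * Shp * (W.tamagawaProduct : ℚ_[p]) / (W.torsionOrder : ℚ_[p]) ^ 2 := by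
    rw [eq_div_iff hT2Q]
    linear_combination heq
  rw [hu', hf0eq, hx_def, hq_def]
  push_cast
  field_simp

/-- **`iff` at rank `0`: on the non-anomalous rows of the (G)-cell (`p ≥ 5`, `E` non-CM, `r_an = 0`)
the MC (G) equality at `T = 0` IS `BSD(E,p)`.** [cite: Delbourgo2002, Theorem (A), (B) (p. 40)]
[cite: Miller2011LMS, Def. 1.1] -/
theorem cycCharLeadingTermAt_iff_bsdp_rankZero (hDel : Delbourgo2002.mainTheorem)
    (hGZK : rank_eq_analyticRank_of_analyticRank_le_one) (hmod : hasEntireLFunction_rat)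
    (hp5 : 5 ≤ p) (hcm : ¬ W.HasCM) (hadd : Addv W p) (hG : TypeGOrd W p)
    (hr : W.analyticRank = 0) (hna : Delbourgo2002.ReductionNonAnomalous W p) :
    CycCharLeadingTermAt W p ↔ BSDp W p :=
  ⟨fun h ↦ bsdp_rankZero_of_typeGOrd_of_cycChar_of_nonAnomalous W p hDel hGZK hmod hp5 hcm hadd hG hr
      h hna,
    cycCharLeadingTermAt_of_bsdp_of_nonAnomalous W p hDel hGZK hmod hp5 hcm hadd hG hr hna⟩

/-! ### Rank `1`: `BSD(E,p)` ⟹ the order-one equality, for every admissible height datum -/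

/-- **CONVERSE at rank `1`.** On the (G)-cell (`Addv ∧ TypeGOrd`, `E` non-CM, `p ≥ 5`,
`ord_{s=1} L(E,s) = 1`), off the anomalous rows, for every height datum `Dh` satisfying Delbourgo's
clauses (B) with `Reg_p(Dh) ≠ 0`: `BSD(E,p)` IMPLIES `CycCharLeadingTermOneAt W p Dh`. (B):
`[T¹]f · log · #tors² = u' · #Ш[p^∞] · Reg_p · ∏c_v`; `BSD(E,p)`: `L'(E,1)/(Ω_E Reg_∞) = #Ш_an · ∏c_v/#tors²`
with `ord_p #Ш_an = ord_p #Ш`; the quotient is the unit `u' · #Ш[p^∞]/#Ш_an`.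
[cite: Delbourgo2002, Theorem (A), (B) (p. 40)] [cite: Miller2011LMS, Def. 1.1] -/
theorem cycCharLeadingTermOneAt_of_bsdp_of_nonAnomalous (hDel : Delbourgo2002.mainTheorem)
    (hGZK : rank_eq_analyticRank_of_analyticRank_le_one) (hmod : hasEntireLFunction_rat)
    (hp5 : 5 ≤ p) (hcm : ¬ W.HasCM) (hadd : Addv W p) (hG : TypeGOrd W p)
    (hr : W.analyticRank = 1) (hna : Delbourgo2002.ReductionNonAnomalous W p)
    {Dh : PAdicHeightData W p} (hB : Delbourgo2002.LeadingTermClauses W p Dh)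
    (hS : SchneiderConjecture Dh) (hbsd : BSDp W p) : CycCharLeadingTermOneAt W p Dh := by
  classical
  have hpP : p.Prime := hp.out
  obtain ⟨hmw, hfin⟩ := hGZK W (by rw [hr])
  have hmw1 : W.mordellWeilRank = 1 := by rw [hmw, hr]
  haveI : Finite W.sha := hfin
  have hfinp : Finite (AddCommGroup.primaryComponent W.sha p) := inferInstance
  have hLne : W.leadingLCoeff ≠ 0 := W.leadingLCoeff_ne_zero_holds (hmod W)
  obtain ⟨-, -, s, hs, hvs⟩ := hbsd
  have hΩpos : 0 < W.realPeriodRat := W.realPeriodRat_pos_holds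
  have hRegpos : 0 < W.regulator := regulator_pos_holds W
  have hT0 : W.torsionOrder ≠ 0 := (W.torsionOrder_pos_holds).ne'
  have hPpos : 0 < W.tamagawaProduct := W.tamagawaProduct_pos_holds
  set q : ℚ := s * (W.tamagawaProduct : ℚ) / (W.torsionOrder : ℚ) ^ 2 with hq_def
  have hLq : W.leadingLCoeff = (q : ℂ) * (W.realPeriodRat : ℂ) * (W.regulator : ℂ) := by
    have hΩC : (W.realPeriodRat : ℂ) ≠ 0 := by exact_mod_cast hΩpos.ne'
    have hRegC : (W.regulator : ℂ) ≠ 0 := by exact_mod_cast hRegpos.ne'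
    have hTC : (W.torsionOrder : ℂ) ≠ 0 := by exact_mod_cast hT0
    have hPC : (W.tamagawaProduct : ℂ) ≠ 0 := by exact_mod_cast hPpos.ne'
    have h := hs
    rw [shaAn_def, div_eq_iff (mul_ne_zero (mul_ne_zero hΩC hPC) hRegC)] at h
    rw [hq_def]
    push_cast
    field_simp
    linear_combination h
  have hs0 : s ≠ 0 := by
    intro h0
    apply hLne
    rw [hLq, hq_def, h0]
    simp
  intro κ γ hκ hγ hγ' D f hf
  haveI : Module.Finite (IwasawaAlgebra p) D.X :=
    SelmerDualData.module_finite_of_isCyclotomic (W := W) (κ := κ) hκ D hγ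
  have hadd' : ¬ W.HasGoodReductionAtPrime p ∧ ¬ W.HasMultiplicativeReductionAtPrime p := hadd
  have hX : D.IsTorsion := Delbourgo2002.mainTheorem.isTorsion hDel hp5 hcm hadd' hG hκ hγ D
  obtain ⟨u, heq⟩ := hB.leadingCoeff_of_nonAnomalous hκ hγ hγ' D hX hf hS hfinp hna
  rw [hmw1, pow_one] at heq
  set A : ℚ_[p] := ((PowerSeries.coeff 1 f : ℤ_[p]) : ℚ_[p]) * padicLog p (cyclotomicGenerator p)
    with hA_def
  set Shp : ℚ_[p] := (Nat.card (AddCommGroup.primaryComponent W.sha p) : ℚ_[p]) with hShp_def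
  set uQ : ℚ_[p] := ((u : ℤ_[p]) : ℚ_[p]) with huQ_def
  have hsQ : ((s : ℚ) : ℚ_[p]) ≠ 0 := by exact_mod_cast hs0
  have hu0 : uQ ≠ 0 := coe_units_ne_zero p u
  have hShp0 : Shp ≠ 0 := by rw [hShp_def]; exact_mod_cast Nat.card_pos.ne'
  have hT2Q : (W.torsionOrder : ℚ_[p]) ^ 2 ≠ 0 := pow_ne_zero 2 (by exact_mod_cast hT0)
  have hPQ : (W.tamagawaProduct : ℚ_[p]) ≠ 0 := by exact_mod_cast hPpos.ne'
  set x : ℚ_[p] := uQ * Shp / ((s : ℚ) : ℚ_[p]) with hx_def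
  have hx0 : x ≠ 0 := by rw [hx_def]; exact div_ne_zero (mul_ne_zero hu0 hShp0) hsQ
  have hxval : x.valuation = 0 := by
    have hprod : x * ((s : ℚ) : ℚ_[p]) = uQ * Shp := by rw [hx_def]; field_simp
    have hv := congrArg Padic.valuation hprod
    rw [Padic.valuation_mul hx0 hsQ, Padic.valuation_mul hu0 hShp0, huQ_def,
      valuation_coe_units_eq_zero, zero_add, Padic.valuation_ratCast, hShp_def,
      Padic.valuation_natCast, hvs] at hv
    linarith
  obtain ⟨u', hu'⟩ := exists_units_coe_eq_of_valuation_eq_zero hx0 hxval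
  refine ⟨u', q, hLq, ?_⟩
  have hAeq : A = uQ * Shp * padicRegulator Dh * (W.tamagawaProduct : ℚ_[p]) /
      (W.torsionOrder : ℚ_[p]) ^ 2 := by
    rw [eq_div_iff hT2Q]
    linear_combination heq
  show A = ((u' : ℤ_[p]) : ℚ_[p]) * ((q : ℚ) : ℚ_[p]) * padicRegulator Dh
  rw [hu', hAeq, hx_def, hq_def]
  push_cast
  field_simp

/-- **`iff` at rank `1`: on the non-anomalous rows of the (G)-cell (`p ≥ 5`, `E` non-CM, `r_an = 1`),
for every height datum with Delbourgo's clauses and `Reg_p ≠ 0`, the typed order-one equality IS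
`BSD(E,p)`.** [cite: Delbourgo2002, Theorem (A), (B) (p. 40)] [cite: Miller2011LMS, Def. 1.1] -/
theorem cycCharLeadingTermOneAt_iff_bsdp_rankOne (hDel : Delbourgo2002.mainTheorem)
    (hGZK : rank_eq_analyticRank_of_analyticRank_le_one) (hmod : hasEntireLFunction_rat)
    (hp5 : 5 ≤ p) (hcm : ¬ W.HasCM) (hadd : Addv W p) (hG : TypeGOrd W p)
    (hr : W.analyticRank = 1) (hna : Delbourgo2002.ReductionNonAnomalous W p)
    {Dh : PAdicHeightData W p} (hB : Delbourgo2002.LeadingTermClauses W p Dh)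
    (hS : SchneiderConjecture Dh) : CycCharLeadingTermOneAt W p Dh ↔ BSDp W p :=
  ⟨fun h ↦ bsdp_rankOne_of_input_of_nonAnomalous W p hDel hGZK hmod hp5 hcm hadd hG hr ⟨Dh, hB, hS, h⟩
      hna,
    cycCharLeadingTermOneAt_of_bsdp_of_nonAnomalous W p hDel hGZK hmod hp5 hcm hadd hG hr hna hB hS⟩

/-- **The rank-one residue predicate IS `BSD(E,p)` modulo the height certificate**: on the
non-anomalous rows of the (G)-cell (`p ≥ 5`, `E` non-CM, `r_an = 1`),
`RankOneIwasawaInputAt W p ↔ BSDp W p ∧ ∃ Dh, LeadingTermClauses W p Dh ∧ SchneiderConjecture Dh`.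
[cite: Delbourgo2002, Theorem (A), (B) (p. 40)] [cite: Miller2011LMS, Def. 1.1] -/
theorem rankOneIwasawaInputAt_iff_bsdp_and_exists_height (hDel : Delbourgo2002.mainTheorem)
    (hGZK : rank_eq_analyticRank_of_analyticRank_le_one) (hmod : hasEntireLFunction_rat)
    (hp5 : 5 ≤ p) (hcm : ¬ W.HasCM) (hadd : Addv W p) (hG : TypeGOrd W p)
    (hr : W.analyticRank = 1) (hna : Delbourgo2002.ReductionNonAnomalous W p) :
    RankOneIwasawaInputAt W p ↔
      BSDp W p ∧ ∃ Dh : PAdicHeightData W p,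
        Delbourgo2002.LeadingTermClauses W p Dh ∧ SchneiderConjecture Dh := by
  constructor
  · rintro ⟨Dh, hB, hS, hA⟩
    exact ⟨bsdp_rankOne_of_input_of_nonAnomalous W p hDel hGZK hmod hp5 hcm hadd hG hr ⟨Dh, hB, hS, hA⟩
      hna, Dh, hB, hS⟩
  · rintro ⟨hbsd, Dh, hB, hS⟩
    exact ⟨Dh, hB, hS, cycCharLeadingTermOneAt_of_bsdp_of_nonAnomalous W p hDel hGZK hmod hp5 hcm hadd
      hG hr hna hB hS hbsd⟩

end Summit.BirchSwinnertonDyer.Rank1Residual.Additive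

end
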